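import Literature.Algebra.Polynomial.CircuitNormMinimiser

/-!
# The minimum of a circuit polynomial in closed form (`f_gp = f*` on a single circuit)

[cite: IlimanDewolff2016GP, Theorem 11 (proof: «Solving (1') for `a_{α,0}` yields
`a_{α,0} ≥ λ_0^{(α)} · |f_α|^{1/λ_0^{(α)}} · ∏_{j=1}^n (λ_j^{(α)}/a_{α,j})^{λ_j^{(α)}/λ_0^{(α)}}`»,
i.e. the circuit-number condition solved for the constant coefficient), Corollary 13 («if
`#Ω(f) = 1`, then `f` is a sum of monomial squares or there always exists a point
`v ∈ (ℝ∖{0})ⁿ` such that `f_α v^α < 0` … and thus `f_gp = f*`»), Corollary 17 («`f_gp = f_0 − m*`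
where `m*` is given by the following geometric program»), and the first example of §5
(«`f = 1/4 + x_1^8 + x_1^2 x_2^6 + 4 x_1^3 x_2^3` … `m* = 4` and hence
`f_gp = 1/4 − 4 = −3.75 = f_sos = f*`»)]
[cite: IlimanDewolff2016, Theorem 3.8 (the circuit-number criterion this rests on)]
[cite: MagronSeidlerDewolff2019, §3.1 («To algorithmically determine a lower bound of p via
SONC …»: the lower bounds certified by `optsonc` are of this kind, one circuit at a time)]

A circuit polynomial with a constant vertex,
`p(x) = b_{j₀} + ∑_{j ≠ j₀} b_j x^{a(j)} + c x^β` (`a(j₀) = 0`, even affinely independent outer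
exponents, `b > 0`, `β = ∑ λ_j a(j)` with barycentric weights `λ > 0`), is nonnegative iff
`|c| ≤ Θ(b, λ)` or the inner term is itself a monomial square term (`c ≥ 0`, `β` even) — the
companion file's `CircuitNormMinimiser.circuitPolynomial_nonneg_iff'`.  Shifting the constant
coefficient, `p − r` is again a circuit polynomial with coefficients `b[j₀ ↦ b_{j₀} − r]`, whose
circuit number is `Θ(b, λ) · ((b_{j₀} − r)/b_{j₀})^{λ_{j₀}}` (`circuitNumber_update`).  Solving
`|c| ≤ Θ(b[j₀ ↦ b_{j₀} − r], λ)` for `r` gives the CLOSED FORM of the best constant: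

  `p − r ≥ 0 on ℝⁿ  ⟺  r ≤ b_{j₀} · (1 − (|c| / Θ(b, λ))^{1/λ_{j₀}})`

for every PROPER circuit polynomial (`c ≠ 0`, and `c < 0` or `β ∉ (2ℕ)ⁿ` — the source's «there
exists `v` with `f_α v^α < 0`»), `circuitPolynomial_sub_const_nonneg_iff`.  Hence
`min_{ℝⁿ} p = b_{j₀}(1 − (|c|/Θ)^{1/λ_{j₀}})`: the bound holds everywhere
(`circuitPolynomial_min_le`), is attained (`exists_circuitPolynomial_eq_min`, via the norm
minimiser of the shifted polynomial, reflected in one odd coordinate when `c > 0`), and is the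
least value (`isLeast_circuitPolynomial`).  In the source's notation this is `f_gp = f_0 − m* = f*`
for a single circuit, with
`m* = b_{j₀} (|c|/Θ)^{1/λ_{j₀}} = λ_0 |c|^{1/λ_0} ∏_{j≥1}(λ_j/b_j)^{λ_j/λ_0}` (`optimalShift_eq`):
the SONC / GP lower bound of a single circuit is EXACT.  Check on the
source's example: `b = (1/4, 1, 1)`, `λ = (1/4, 1/4, 1/2)`, `Θ = 1 · 4^{1/4} · 2^{1/2} = 2`,
`|c| = 4`, so `m* = (1/4)(4/2)^4 = 4` and `f* = 1/4 − 4 = −3.75`, as printed there.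

All statements are fully proved; no named facts are introduced.  Not formalised: the
multi-circuit bound `f_gp` of [IlimanDewolff2016GP, Thm. 11 / Cor. 17] (a genuine optimisation
over the splitting variables `a_{α,j}`), and `f_sos ≤ f_gp`.
-/

namespace Literature.Algebra.Polynomial.CircuitOptimalConstant

open Finset Matrix Literature.Algebra.Polynomial.CircuitNumberNonnegativity
open Literature.Algebra.Polynomial.CircuitNormMinimiser

/-! ### Solving the circuit condition for the constant coefficient -/

/-- Real-number form of «solving (1') for `a_{α,0}`»: for `C ≥ 0`, `Θ > 0`, `u ≥ 0`, `μ > 0`,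
`C ≤ Θ u^μ ⟺ (C/Θ)^{1/μ} ≤ u`.
[cite: IlimanDewolff2016GP, Theorem 11 (proof, the display solving (1') for a_{α,0})] -/
theorem le_mul_rpow_iff {C Θ u μ : ℝ} (hC : 0 ≤ C) (hΘ : 0 < Θ) (hu : 0 ≤ u) (hμ : 0 < μ) :
    C ≤ Θ * u ^ μ ↔ (C / Θ) ^ (1 / μ) ≤ u := by
  rw [one_div, Real.rpow_inv_le_iff_of_pos (div_nonneg hC hΘ.le) hu hμ, div_le_iff₀ hΘ,
    mul_comm]

section CircuitNumber

variable {ι : Type*} [Fintype ι] [DecidableEq ι]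

/-- **Circuit number after changing one coefficient**: replacing `b_{j₀}` by `t ≥ 0` multiplies
`Θ(b, λ) = ∏ (b_j/λ_j)^{λ_j}` by `(t / b_{j₀})^{λ_{j₀}}`.  (Used with `t = b_{j₀} − r`: the circuit
number of `p − r`.)
[cite: IlimanDewolff2016GP, Theorem 11 (proof: homogenisation `F − r x_0^{2d}` has constant
coefficient `f_0 − r`, condition (1'))] -/
theorem circuitNumber_update {b w : ι → ℝ} (hb : ∀ j, 0 < b j) (hw : ∀ j, 0 < w j) (j₀ : ι)
    {t : ℝ} (ht : 0 ≤ t) :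
    circuitNumber (Function.update b j₀ t) w = circuitNumber b w * (t / b j₀) ^ w j₀ := by
  have hrhs : circuitNumber b w * (t / b j₀) ^ w j₀
      = ∏ j, ((b j / w j) ^ w j * if j = j₀ then (t / b j₀) ^ w j₀ else 1) := by
    rw [prod_mul_distrib, prod_ite_eq', if_pos (mem_univ j₀), circuitNumber]
  rw [hrhs, circuitNumber]
  refine prod_congr rfl fun j _ => ?_
  by_cases hj : j = j₀
  · subst hj
    rw [Function.update_self, if_pos rfl, ← Real.mul_rpow (div_nonneg (hb j).le (hw j).le)
      (div_nonneg ht (hb j).le), div_mul_div_comm, mul_comm (b j) t,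
      mul_div_mul_right _ _ (hb j).ne']
  · rw [Function.update_of_ne hj, if_neg hj, mul_one]

omit [DecidableEq ι] in
/-- The optimal shift in the two printed forms: `b_{j₀} (|c|/Θ(b,λ))^{1/λ_{j₀}}` equals the
source's `m* = λ_{j₀} |c|^{1/λ_{j₀}} ∏_{j ≠ j₀} (λ_j/b_j)^{λ_j/λ_{j₀}}` — here written with the
full product `∏_j (λ_j/b_j)^{λ_j/λ_{j₀}}`, whose `j₀`-th factor `(λ_{j₀}/b_{j₀})` accounts for the
prefactor: `b_{j₀} (|c|/Θ)^{1/λ_{j₀}} = b_{j₀} |c|^{1/λ_{j₀}} ∏_j (λ_j/b_j)^{λ_j/λ_{j₀}}`.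
[cite: IlimanDewolff2016GP, Theorem 11 (3) and Corollary 17 (the objective
`λ_0 |f_α|^{1/λ_0} ∏ (λ_j/a_{α,j})^{λ_j/λ_0}` at `a_{α,j} = f_{α(j)}`)] -/
theorem optimalShift_eq {b w : ι → ℝ} (hb : ∀ j, 0 < b j) (hw : ∀ j, 0 < w j) (j₀ : ι)
    (c : ℝ) :
    b j₀ * (|c| / circuitNumber b w) ^ (1 / w j₀)
      = b j₀ * |c| ^ (1 / w j₀) * ∏ j, (w j / b j) ^ (w j / w j₀) := by
  have hΘ : 0 < circuitNumber b w := circuitNumber_pos hb hw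
  have hinv : (circuitNumber b w)⁻¹ = ∏ j, (w j / b j) ^ w j := by
    rw [circuitNumber, ← prod_inv_distrib]
    refine prod_congr rfl fun j _ => ?_
    rw [← Real.inv_rpow (div_nonneg (hb j).le (hw j).le), inv_div]
  rw [div_eq_mul_inv, Real.mul_rpow (abs_nonneg c) (inv_nonneg.mpr hΘ.le), hinv,
    ← Real.finsetProd_rpow _ _ (fun j _ => Real.rpow_nonneg (div_nonneg (hw j).le (hb j).le) _),
    mul_assoc]
  congr 2
  refine prod_congr rfl fun j _ => ?_
  rw [← Real.rpow_mul (div_nonneg (hw j).le (hb j).le), mul_one_div]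

end CircuitNumber

/-! ### The closed-form minimum -/

section Polynomial

variable {ι : Type*} [Fintype ι] [DecidableEq ι] {n : Type*} [Fintype n]

/-- Shifting the constant: if `a(j₀) = 0` then
`p(x) − r = ∑_j b[j₀ ↦ b_{j₀} − r]_j x^{a(j)} + c x^β` — `p − r` is the circuit polynomial with the
same support and the constant coefficient lowered by `r`.
[cite: IlimanDewolff2016GP, Theorem 11 (proof: «F − r x_0^{2d} = (f_0 − r) x_0^{2d} + …»)] -/
theorem circuitPolynomial_sub_const {b : ι → ℝ} {a : ι → n → ℕ} {j₀ : ι} (hj₀ : ∀ i, a j₀ i = 0)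
    (c r : ℝ) (β : n → ℕ) (x : n → ℝ) :
    ∑ j, b j * ∏ i, x i ^ a j i + c * ∏ i, x i ^ β i - r
      = ∑ j, Function.update b j₀ (b j₀ - r) j * ∏ i, x i ^ a j i + c * ∏ i, x i ^ β i := by
  have h1 : ∏ i, x i ^ a j₀ i = 1 := by simp [hj₀]
  have h2 : ∑ j, Function.update b j₀ (b j₀ - r) j * ∏ i, x i ^ a j i
      = ∑ j, b j * ∏ i, x i ^ a j i + ∑ j, (if j = j₀ then -r else 0) := by
    rw [← sum_add_distrib]
    refine sum_congr rfl fun j _ => ?_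
    by_cases hj : j = j₀
    · subst hj
      rw [Function.update_self, if_pos rfl, h1]
      ring
    · rw [Function.update_of_ne hj, if_neg hj, add_zero]
  rw [h2, sum_ite_eq', if_pos (mem_univ j₀)]
  ring

/-- **The best constant in closed form** (`f_gp = f*` for a single circuit).  For a proper circuit
polynomial with a constant vertex — `a(j₀) = 0`, even affinely independent outer exponents,
`b > 0`, `β = ∑ λ_j a(j)` with `λ > 0`, `∑ λ_j = 1`, inner coefficient `c ≠ 0` with `c < 0` or
`β ∉ (2ℕ)ⁿ` — and every `r ∈ ℝ`:
`p − r ≥ 0 on ℝⁿ ⟺ r ≤ b_{j₀} (1 − (|c| / Θ(b, λ))^{1/λ_{j₀}})`.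
(For `r < b_{j₀}`: `p − r` is the circuit polynomial with constant coefficient `b_{j₀} − r > 0`, so
by Theorem 3.8 it is nonnegative iff `|c| ≤ Θ(b,λ)((b_{j₀} − r)/b_{j₀})^{λ_{j₀}}`, which is the
stated inequality; for `r ≥ b_{j₀}` both sides fail, since `m* > 0`.)
[cite: IlimanDewolff2016GP, Corollary 13 («if #Ω(f) = 1 … f_gp = f*») with Theorem 11 (3) /
Corollary 17 (f_gp = f_0 − m*)]
[cite: IlimanDewolff2016, Theorem 3.8] -/
theorem circuitPolynomial_sub_const_nonneg_iff {b w : ι → ℝ} (hb : ∀ j, 0 < b j)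
    (hw : ∀ j, 0 < w j) (hw1 : ∑ j, w j = 1) {a : ι → n → ℕ} (ha : ∀ j i, Even (a j i))
    (hα : AffineIndependent ℝ fun j i => (a j i : ℝ)) {β : n → ℕ}
    (hβ : ∀ i, (β i : ℝ) = ∑ j, w j * a j i) {j₀ : ι} (hj₀ : ∀ i, a j₀ i = 0) {c : ℝ}
    (hc0 : c ≠ 0) (hprop : c < 0 ∨ ∃ i, Odd (β i)) (r : ℝ) :
    (∀ x : n → ℝ, r ≤ ∑ j, b j * ∏ i, x i ^ a j i + c * ∏ i, x i ^ β i) ↔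
      r ≤ b j₀ * (1 - (|c| / circuitNumber b w) ^ (1 / w j₀)) := by
  have hΘ : 0 < circuitNumber b w := circuitNumber_pos hb hw
  set m : ℝ := b j₀ * (|c| / circuitNumber b w) ^ (1 / w j₀) with hm_def
  have hm : 0 < m :=
    mul_pos (hb j₀) (Real.rpow_pos_of_pos (div_pos (abs_pos.mpr hc0) hΘ) _)
  have hnot : ¬ (0 ≤ c ∧ ∀ i, Even (β i)) := by
    rintro ⟨hc, he⟩
    rcases hprop with h | ⟨i, hi⟩
    · linarith
    · exact (Nat.not_even_iff_odd.mpr hi) (he i)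
  -- the claim for `r < b j₀`, where `p − r` has positive coefficients
  have step : ∀ s : ℝ, s < b j₀ →
      ((∀ x : n → ℝ, s ≤ ∑ j, b j * ∏ i, x i ^ a j i + c * ∏ i, x i ^ β i) ↔ s ≤ b j₀ - m) := by
    intro s hs
    have hb' : ∀ j, 0 < Function.update b j₀ (b j₀ - s) j := by
      intro j
      by_cases hj : j = j₀
      · subst hj
        rw [Function.update_self]
        linarith
      · rw [Function.update_of_ne hj]
        exact hb j
    have hL : (∀ x : n → ℝ, s ≤ ∑ j, b j * ∏ i, x i ^ a j i + c * ∏ i, x i ^ β i) ↔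
        ∀ x : n → ℝ, 0 ≤ ∑ j, Function.update b j₀ (b j₀ - s) j * ∏ i, x i ^ a j i
          + c * ∏ i, x i ^ β i := by
      refine forall_congr' fun x => ?_
      rw [← circuitPolynomial_sub_const hj₀ c s β x, sub_nonneg]
    rw [hL, circuitPolynomial_nonneg_iff' hb' hw hw1 ha hα hβ, or_iff_right hnot,
      circuitNumber_update hb hw j₀ (by linarith),
      le_mul_rpow_iff (abs_nonneg c) hΘ (div_nonneg (by linarith) (hb j₀).le) (hw j₀),
      le_div_iff₀ (hb j₀)]
    constructor <;> intro h <;> linarith [hm_def]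
  by_cases hr : r < b j₀
  · rw [step r hr, hm_def]
    constructor <;> intro h <;> linarith
  · have hr' : b j₀ ≤ r := not_lt.mp hr
    constructor
    · intro h
      exfalso
      have h1 := (step (b j₀ - m / 2) (by linarith)).mp fun x => by linarith [h x]
      linarith
    · intro h
      exfalso
      have : r ≤ b j₀ - m := by rw [hm_def]; linarith
      linarith

/-- The closed-form value is a lower bound everywhere: `p(x) ≥ b_{j₀}(1 − (|c|/Θ)^{1/λ_{j₀}})`.
[cite: IlimanDewolff2016GP, Theorem 11 (f − r is a SONC, hence nonnegative, for r ≤ f_gp)] -/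
theorem circuitPolynomial_min_le {b w : ι → ℝ} (hb : ∀ j, 0 < b j) (hw : ∀ j, 0 < w j)
    (hw1 : ∑ j, w j = 1) {a : ι → n → ℕ} (ha : ∀ j i, Even (a j i))
    (hα : AffineIndependent ℝ fun j i => (a j i : ℝ)) {β : n → ℕ}
    (hβ : ∀ i, (β i : ℝ) = ∑ j, w j * a j i) {j₀ : ι} (hj₀ : ∀ i, a j₀ i = 0) {c : ℝ}
    (hc0 : c ≠ 0) (hprop : c < 0 ∨ ∃ i, Odd (β i)) (x : n → ℝ) :
    b j₀ * (1 - (|c| / circuitNumber b w) ^ (1 / w j₀))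
      ≤ ∑ j, b j * ∏ i, x i ^ a j i + c * ∏ i, x i ^ β i :=
  (circuitPolynomial_sub_const_nonneg_iff hb hw hw1 ha hα hβ hj₀ hc0 hprop _).mpr le_rfl x

/-- … and no larger constant is: for `r > b_{j₀}(1 − (|c|/Θ)^{1/λ_{j₀}})`, `p` takes a value `< r`.
[cite: IlimanDewolff2016GP, Corollary 13 («f_gp = f*» for #Ω(f) = 1: the bound is the
minimum)] -/
theorem exists_circuitPolynomial_lt {b w : ι → ℝ} (hb : ∀ j, 0 < b j) (hw : ∀ j, 0 < w j)
    (hw1 : ∑ j, w j = 1) {a : ι → n → ℕ} (ha : ∀ j i, Even (a j i))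
    (hα : AffineIndependent ℝ fun j i => (a j i : ℝ)) {β : n → ℕ}
    (hβ : ∀ i, (β i : ℝ) = ∑ j, w j * a j i) {j₀ : ι} (hj₀ : ∀ i, a j₀ i = 0) {c : ℝ}
    (hc0 : c ≠ 0) (hprop : c < 0 ∨ ∃ i, Odd (β i)) {r : ℝ}
    (hr : b j₀ * (1 - (|c| / circuitNumber b w) ^ (1 / w j₀)) < r) :
    ∃ x : n → ℝ, ∑ j, b j * ∏ i, x i ^ a j i + c * ∏ i, x i ^ β i < r := by
  by_contra h
  push Not at h
  exact (not_le.mpr hr)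
    ((circuitPolynomial_sub_const_nonneg_iff hb hw hw1 ha hα hβ hj₀ hc0 hprop r).mp h)

/-- **The minimum is attained, case `c < 0`**: at `r* = b_{j₀}(1 − (|c|/Θ)^{1/λ_{j₀}})` the shifted
polynomial `p − r*` has constant coefficient `b_{j₀}(|c|/Θ)^{1/λ_{j₀}}` and circuit number EXACTLY
`|c| = −c`, so it vanishes at its norm minimiser `e^{s*}`
(`CircuitNormMinimiser.exists_signomial_eq_zero`).
[cite: IlimanDewolff2016, Proposition 13 («s* is a root … of f(e^w)» for c = −Θ_f)]
[cite: IlimanDewolff2016GP, Corollary 13 (f_gp = f*)] -/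
theorem exists_circuitPolynomial_eq_min_of_neg {b w : ι → ℝ} (hb : ∀ j, 0 < b j)
    (hw : ∀ j, 0 < w j) (hw1 : ∑ j, w j = 1) {a : ι → n → ℕ}
    (hα : AffineIndependent ℝ fun j i => (a j i : ℝ)) {β : n → ℕ}
    (hβ : ∀ i, (β i : ℝ) = ∑ j, w j * a j i) {j₀ : ι} (hj₀ : ∀ i, a j₀ i = 0) {c : ℝ}
    (hc : c < 0) :
    ∃ x : n → ℝ, ∑ j, b j * ∏ i, x i ^ a j i + c * ∏ i, x i ^ β i
      = b j₀ * (1 - (|c| / circuitNumber b w) ^ (1 / w j₀)) := by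
  have hΘ : 0 < circuitNumber b w := circuitNumber_pos hb hw
  set t : ℝ := (|c| / circuitNumber b w) ^ (1 / w j₀) with ht_def
  have hq : 0 ≤ |c| / circuitNumber b w := div_nonneg (abs_nonneg c) hΘ.le
  have ht0 : 0 < t := Real.rpow_pos_of_pos (div_pos (abs_pos.mpr hc.ne) hΘ) _
  have htw : t ^ w j₀ = |c| / circuitNumber b w := by
    rw [ht_def, one_div, Real.rpow_inv_rpow hq (hw j₀).ne']
  have hb' : ∀ j, 0 < Function.update b j₀ (b j₀ * t) j := by
    intro j
    by_cases hj : j = j₀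
    · subst hj
      rw [Function.update_self]
      exact mul_pos (hb j) ht0
    · rw [Function.update_of_ne hj]
      exact hb j
  have hΘ' : circuitNumber (Function.update b j₀ (b j₀ * t)) w = -c := by
    rw [circuitNumber_update hb hw j₀ (mul_pos (hb j₀) ht0).le, mul_div_cancel_left₀ t (hb j₀).ne',
      htw, mul_comm, div_mul_cancel₀ _ hΘ.ne', abs_of_neg hc]
  obtain ⟨y, hy, -⟩ := exists_signomial_eq_zero hb' hw hw1 hα hβ
  rw [hΘ', neg_neg] at hy
  refine ⟨fun i => Real.exp (y i), ?_⟩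
  have h := circuitPolynomial_sub_const (b := b) hj₀ c (b j₀ * (1 - t)) β fun i => Real.exp (y i)
  have e : b j₀ - b j₀ * (1 - t) = b j₀ * t := by ring
  rw [e] at h
  simp only [prod_exp_pow_eq_exp_dotProduct] at h
  rw [hy] at h
  have h' : ∑ j, b j * ∏ i, Real.exp (y i) ^ a j i + c * ∏ i, Real.exp (y i) ^ β i
      = b j₀ * (1 - t) := by
    simp only [prod_exp_pow_eq_exp_dotProduct]
    linarith
  exact h'

/-- **The minimum is attained, case `c > 0` with an odd inner coordinate `β_k`**: reflect the
`k`-th variable (`x_k ↦ −x_k` turns `c` into `−c` and fixes the even outer monomials) and use the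
previous case.
[cite: IlimanDewolff2016, Theorem 3.8 (proof: the sign symmetry `x_k ↦ −x_k` for y ∉ (2ℕ)ⁿ)]
[cite: IlimanDewolff2016GP, Corollary 13 (f_gp = f*)] -/
theorem exists_circuitPolynomial_eq_min_of_odd [DecidableEq n] {b w : ι → ℝ} (hb : ∀ j, 0 < b j)
    (hw : ∀ j, 0 < w j) (hw1 : ∑ j, w j = 1) {a : ι → n → ℕ} (ha : ∀ j i, Even (a j i))
    (hα : AffineIndependent ℝ fun j i => (a j i : ℝ)) {β : n → ℕ}
    (hβ : ∀ i, (β i : ℝ) = ∑ j, w j * a j i) {j₀ : ι} (hj₀ : ∀ i, a j₀ i = 0) {c : ℝ}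
    (hc : 0 < c) {k : n} (hk : Odd (β k)) :
    ∃ x : n → ℝ, ∑ j, b j * ∏ i, x i ^ a j i + c * ∏ i, x i ^ β i
      = b j₀ * (1 - (|c| / circuitNumber b w) ^ (1 / w j₀)) := by
  obtain ⟨x, hx⟩ := exists_circuitPolynomial_eq_min_of_neg hb hw hw1 hα hβ hj₀ (c := -c)
    (neg_lt_zero.mpr hc)
  refine ⟨fun i => if i = k then -x i else x i, ?_⟩
  rw [circuitPolynomial_reflect ha hk c x, hx, abs_neg]

/-- **Attainment for every proper circuit polynomial** (`c ≠ 0`; `c < 0` or `β ∉ (2ℕ)ⁿ`).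
[cite: IlimanDewolff2016GP, Corollary 13 (f_gp = f* for #Ω(f) = 1)] -/
theorem exists_circuitPolynomial_eq_min [DecidableEq n] {b w : ι → ℝ} (hb : ∀ j, 0 < b j)
    (hw : ∀ j, 0 < w j) (hw1 : ∑ j, w j = 1) {a : ι → n → ℕ} (ha : ∀ j i, Even (a j i))
    (hα : AffineIndependent ℝ fun j i => (a j i : ℝ)) {β : n → ℕ}
    (hβ : ∀ i, (β i : ℝ) = ∑ j, w j * a j i) {j₀ : ι} (hj₀ : ∀ i, a j₀ i = 0) {c : ℝ}
    (hc0 : c ≠ 0) (hprop : c < 0 ∨ ∃ i, Odd (β i)) :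
    ∃ x : n → ℝ, ∑ j, b j * ∏ i, x i ^ a j i + c * ∏ i, x i ^ β i
      = b j₀ * (1 - (|c| / circuitNumber b w) ^ (1 / w j₀)) := by
  rcases lt_or_gt_of_ne hc0 with hc | hc
  · exact exists_circuitPolynomial_eq_min_of_neg hb hw hw1 hα hβ hj₀ hc
  · rcases hprop with h | ⟨k, hk⟩
    · exact absurd h (not_lt.mpr hc.le)
    · exact exists_circuitPolynomial_eq_min_of_odd hb hw hw1 ha hα hβ hj₀ hc hk

/-- **`f_gp = f* = min p` for a single circuit**: the closed-form constant
`b_{j₀}(1 − (|c|/Θ(b,λ))^{1/λ_{j₀}})` is the LEAST value of a proper circuit polynomial on `ℝⁿ`.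
[cite: IlimanDewolff2016GP, Corollary 13 («Particularly, if #Ω(f) = 1, then … f_gp = f*») and
Corollary 17 («f_gp = f_0 − m*»)] -/
theorem isLeast_circuitPolynomial [DecidableEq n] {b w : ι → ℝ} (hb : ∀ j, 0 < b j)
    (hw : ∀ j, 0 < w j) (hw1 : ∑ j, w j = 1) {a : ι → n → ℕ} (ha : ∀ j i, Even (a j i))
    (hα : AffineIndependent ℝ fun j i => (a j i : ℝ)) {β : n → ℕ}
    (hβ : ∀ i, (β i : ℝ) = ∑ j, w j * a j i) {j₀ : ι} (hj₀ : ∀ i, a j₀ i = 0) {c : ℝ}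
    (hc0 : c ≠ 0) (hprop : c < 0 ∨ ∃ i, Odd (β i)) :
    IsLeast (Set.range fun x : n → ℝ => ∑ j, b j * ∏ i, x i ^ a j i + c * ∏ i, x i ^ β i)
      (b j₀ * (1 - (|c| / circuitNumber b w) ^ (1 / w j₀))) := by
  refine ⟨?_, ?_⟩
  · obtain ⟨x, hx⟩ := exists_circuitPolynomial_eq_min hb hw hw1 ha hα hβ hj₀ hc0 hprop
    exact ⟨x, hx⟩
  · rintro _ ⟨x, rfl⟩
    exact circuitPolynomial_min_le hb hw hw1 ha hα hβ hj₀ hc0 hprop x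

/-- The improper case for contrast: if `c ≥ 0` and `β ∈ (2ℕ)ⁿ` then every term of `p` is a
nonnegative multiple of an even monomial and `min p = p(0) = b_{j₀}` («f is a sum of monomial
squares»), provided every other outer monomial and the inner monomial actually involve a variable.
[cite: IlimanDewolff2016GP, Corollary 13 («then f is a sum of monomial squares or …»)] -/
theorem isLeast_circuitPolynomial_of_even {b : ι → ℝ} (hb : ∀ j, 0 < b j) {a : ι → n → ℕ}
    (ha : ∀ j i, Even (a j i)) {β : n → ℕ} (hβe : ∀ i, Even (β i)) {j₀ : ι}
    (hj₀ : ∀ i, a j₀ i = 0) (hne : ∀ j, j ≠ j₀ → ∃ i, a j i ≠ 0) (hβ0 : ∃ i, β i ≠ 0) {c : ℝ}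
    (hc : 0 ≤ c) :
    IsLeast (Set.range fun x : n → ℝ => ∑ j, b j * ∏ i, x i ^ a j i + c * ∏ i, x i ^ β i)
      (b j₀) := by
  refine ⟨⟨0, ?_⟩, ?_⟩
  · have hz : ∀ j, b j * ∏ i, (0 : n → ℝ) i ^ a j i = if j = j₀ then b j₀ else 0 := by
      intro j
      by_cases hj : j = j₀
      · subst hj
        simp [hj₀]
      · obtain ⟨i, hi⟩ := hne j hj
        rw [if_neg hj, prod_eq_zero (mem_univ i) (by rw [Pi.zero_apply, zero_pow hi]), mul_zero]
    obtain ⟨i, hi⟩ := hβ0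
    simp only [hz, sum_ite_eq', mem_univ, if_true]
    rw [prod_eq_zero (mem_univ i) (by rw [Pi.zero_apply, zero_pow hi]), mul_zero, add_zero]
  · rintro _ ⟨x, rfl⟩
    have hle : b j₀ * ∏ i, x i ^ a j₀ i ≤ ∑ j, b j * ∏ i, x i ^ a j i :=
      single_le_sum (f := fun j => b j * ∏ i, x i ^ a j i)
        (fun j _ => mul_nonneg (hb j).le (prod_nonneg fun i _ => (ha j i).pow_nonneg _))
        (mem_univ j₀)
    simp only [hj₀, pow_zero, prod_const_one, mul_one] at hle
    have hin : 0 ≤ c * ∏ i, x i ^ β i :=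
      mul_nonneg hc (prod_nonneg fun i _ => (hβe i).pow_nonneg _)
    show b j₀ ≤ _
    linarith

end Polynomial

end Literature.Algebra.Polynomial.CircuitOptimalConstant
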